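import Literature.Barriers.CriticalPhenomena.PlaquetteWalkHoleRootThinSide
import HarnessLib

/-!
# Barrier catalogue (SAWScalingLimit): THE EAST WALL — the root plaquette's eastern neighbour on the wall EMPTIES BOTH
routes (`VF ≡ 0`); an eastern pocket on the wall `w₁`-kills both (`VF(2π/3) = 0`); LAW L's residual east cells, all boxes

Leaf of `PlaquetteWalkHoleRootThinSide`, in the line of `PlaquetteWalkHoleRootStructuralKill` (`kindsIn_root_eq_of_cross_root_S`:
an excursion crossing the root plaquette's bottom side forces two `θ`-corner arcs in the root plaquette `w`). The winding
parity law: a wound class-`B2a` walk at the far cell has an odd — so non-zero — number of excursion crossings of the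
eastern ray of the hole, the bottom line of the root row from `w` eastwards. If the cells east of `w` are arranged so
that only the ray's FIRST edge (the bottom side of `w`) can be crossed — the second edge `(w.1 + 1, w.2 − 1) | (w.1 + 1, w.2)`
shut from either side and the wall beyond (`(x, w.2) ∉ D ∨ (x, w.2 − 1) ∉ D` for `x ≥ w.1 + 2`) — then EVERY wound walk,
under or over, crosses the bottom side of `w` and carries two `θ`-corner arcs in `w` (§2 ★★★★
`ΩG.kindsIn_root_eq_of_AJ_ne_zero_eastWall`, `ΩG.not_W1FreeOff_of_wound_eastWall`). Two consequences. (A) §3: if the cell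
`(w.1 + 1, w.2)` east of `w` is itself absent, the second corner arc has no `E` door: ★★★★★
`ΩG.WE_eq_excursionWinding_of_eastWallRootE` — NO WALK AT THE FAR CELL IS WOUND, both route masses vanish and ★★★★★
`vertexFunctional_printed_eq_zero_of_eastWallRootE`: the vertex relation HOLDS at the far cell for every
`θ ∈ [π/3, 2π/3]` (a vacuous zero of a new kind: the far cell's doors are all open). (B) §4: if instead an eastern pocket
`(w.1 + 1, w.2 ∓ 1)` is absent (wall beyond), every wound walk is `w₁`-marked: ★★★★ the dual honeycomb zero
`vertexFunctional_printed_two_pi_div_three_eq_zero_of_eastWallPocketSE` (`VF(2π/3) = 0`), and by the row mirror the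
north-eastern pocket gives the honeycomb zero `VF(π/3) = 0`. §5 ALL BOXES with the hole two columns from the eastern
wall (`h.1 + 3 = m`): removing `(h.1 + 2, h.2)` ⇒ `VF(θ) = 0` on the whole range (`lawL_box_eastWallRootE_vertexFunctional_eq_zero`);
removing `(h.1 + 2, h.2 − 1)` ⇒ `VF(2π/3) = 0`; removing `(h.1 + 2, h.2 + 1)` ⇒ `VF(π/3) = 0`. These are LAW L's three
east «residual» cells.

Not in print; venture lane «pcv-sawmu», seat b-step0 gen 26.

References: A. Glazman, I. Manolescu, arXiv:1708.00395v3, §1 (Fig. 1, Fig. 2, remark after eq. (1)), §2.1, §4.2 and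
Lemma 2.1 [GlazmanManolescu2019]; A. Glazman, Electron. Commun. Probab. 20 (2015) no. 86, Lemma 3.1, proof pp. 6–7
[Glazman2015WeightedSAW]; R. Courant, H. Robbins, *What is Mathematics?* (1941/1958), Ch. V Appendix §2 (the even–odd
rule) [CourantRobbins1958].
-/

noncomputable section

open Set Function Complex

namespace Literature.Probability.RandomPlanarGeometry.SAW.YangBaxter

open Real
open Literature.Barriers.CriticalPhenomena.PlaquetteWalk (mirrorRowFace mirrorRowFace_mirrorRowFace)

open private side_jOut from Literature.Probability.RandomPlanarGeometry.YangBaxterSAWExcursionJordan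

/-! ## §1 Corner arcs and the root plaquette's `E` side -/

/-- A `θ`-corner arc avoiding the `E` side passes through the `N` side. [cite: GlazmanManolescu2019, §1, Fig. 1 (the two θ-corner arcs)] -/
theorem corner_side_N_of_ne_E {s t : Side} (hc : arcKind s t = .corner) (hs : s ≠ .E) (ht : t ≠ .E) :
    s = .N ∨ t = .N := by
  revert hc hs ht; cases s <;> cases t <;> decide

/-- The cell behind the root plaquette's `E` side. [cite: GlazmanManolescu2019, §1 (the lattice of rhombi and its mid-edges)] -/
theorem root_side_E_faces_snd (w : Face) : (w.side .E).faces.2 = ((w.1 + 1, w.2) : Face) := by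
  obtain ⟨a, b⟩ := w; rfl

/-- No side of the far cell is the root plaquette's `E` side. [cite: GlazmanManolescu2019, §1 (the lattice of rhombi and its mid-edges)] -/
theorem farW_side_ne_root_side_E (w : Face) (s : Side) : (farW w).side s ≠ w.side .E := by
  obtain ⟨a, b⟩ := w
  cases s <;> simp only [farW, Face.side, ne_eq, MidEdge.vert.injEq, and_true, reduceCtorEq, not_false_eq_true] <;>
    omega

/-- The root mid-edge is not the root plaquette's `E` side. [cite: GlazmanManolescu2019, §1 (the lattice of rhombi and its mid-edges)] -/
theorem root_side_W_ne_root_side_E (w : Face) : w.side .W ≠ w.side .E := by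
  obtain ⟨a, b⟩ := w
  simp [Face.side]

namespace ΩG

variable {D : Set Face} {w : Face}

/-! ## §2 The east wall: every winding excursion crosses the root plaquette's bottom side -/

/-- ★★★★ **ON THE EAST WALL EVERY WINDING EXCURSION CROSSES THE ROOT PLAQUETTE'S BOTTOM SIDE, SO `w` CARRIES TWO
`θ`-CORNER ARCS.** Hole absent; the second edge of the hole's eastern ray shut from either side (`(w.1 + 1, w.2) ∉ D` or
`(w.1 + 1, w.2 − 1) ∉ D`); the wall beyond (`(x, w.2) ∉ D ∨ (x, w.2 − 1) ∉ D` for `x ≥ w.1 + 2`). A class-`B2a` walk at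
the far cell with non-zero swept angle has an odd eastern ray count; a crossed ray edge has both faces in `D`, so it is
the edge `m = 0` — the bottom side of `w` — and `kindsIn_root_eq_of_cross_root_S` applies.
[cite: CourantRobbins1958, Ch. V Appendix §2 (the even–odd rule)] [cite: Glazman2015WeightedSAW, Lemma 3.1 (proof, pp. 6–7)]
[cite: GlazmanManolescu2019, §1 (Fig. 1), Lemma 2.1] -/
theorem kindsIn_root_eq_of_AJ_ne_zero_eastWall (hh : holeFaceW w ∉ D)
    (hSE : ((w.1 + 1, w.2) : Face) ∉ D ∨ ((w.1 + 1, w.2 - 1) : Face) ∉ D)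
    (heast : ∀ x : ℤ, w.1 + 2 ≤ x → ((x, w.2) : Face) ∉ D ∨ ((x, w.2 - 1) : Face) ∉ D)
    (ω : ΩG D (w.side .W) (farW w)) (hr : RootedFace D (w.side .W) (farW w)) (h : ω.IsB2a)
    (hA : ω.AJ hr h (toC (midPt (w.side .W))) ≠ 0) : ω.2.kindsIn w = [.corner, .corner] := by
  classical
  have hodd := (ω.AJ_root_ne_zero_iff_odd_rayCountAt (hr := hr) h (b := holeFaceW w) (τ := .E)
    (holeFaceW_side_E w)).1 hA
  have hF := ω.fh_lt h
  have hB2 : ω.2.firstHitG + 1 < ω.2.arcs.length := h.1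
  have hpos := hodd.pos
  unfold ΩG.rayCountAt at hpos
  rw [Finset.card_pos] at hpos
  obtain ⟨j, hj⟩ := hpos
  rw [Finset.mem_filter, Finset.mem_range] at hj
  obtain ⟨hjM, m, hm⟩ := hj
  have hjM' : ω.2.firstHitG + j + 1 ≤ ω.2.arcs.length := by unfold ΩG.Mv at hjM; omega
  rw [side_jOut (hr := hr) h hjM] at hm
  -- the crossed ray edge is an interior mid-edge of the walk: both its faces lie in `D`
  have hlt : ω.2.firstHitG + j + 1 < ω.2.arcs.length := by
    rcases lt_or_eq_of_le hjM' with hl | he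
    · exact hl
    · exfalso
      rw [he, ω.2.nth_length, rayMid_holeFaceW_E_eq] at hm
      exact farW_side_ne_slant_east w ω.1 m hm
  have hd := ω.2.door_nth (j := ω.2.firstHitG + j + 1) (by omega) hlt
  rw [hm, rayMid_holeFaceW_E_eq] at hd
  simp only [MidEdge.faces] at hd
  -- so it is the edge `m = 0`: the bottom side of the root plaquette
  have hm0 : m = 0 := by
    by_contra hne
    rcases Nat.lt_or_ge m 2 with hl | hge
    · have e1 : (m : ℤ) = 1 := by omega
      rw [e1] at hd
      rcases hSE with hx | hx
      · exact hx hd.2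
      · exact hx hd.1
    · rcases heast (w.1 + m) (by omega) with hx | hx
      · exact hx hd.2
      · exact hx hd.1
  rw [hm0, ← root_side_S_eq_rayMid] at hm
  exact (ω.kindsIn_root_eq_of_cross_root_S hh hr h ⟨ω.2.firstHitG + j, by omega, by omega, hm⟩).2

/-- ★★★★ **ON THE EAST WALL EVERY WOUND WALK — under or over — IS `w₁`-MARKED** (two `θ`-corner arcs in the root
plaquette; either orientation of the winding witness, the reversed companion having the same kinds in `w`).
[cite: GlazmanManolescu2019, §1, remark after eq. (1) («w₁ = 0 at θ = 2π/3»), Lemma 2.1]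
[cite: Glazman2015WeightedSAW, Lemma 3.1 (proof, pp. 6–7)] [cite: CourantRobbins1958, Ch. V Appendix §2 (the even–odd rule)] -/
theorem kindsIn_root_eq_of_wound_eastWall (hh : holeFaceW w ∉ D)
    (hSE : ((w.1 + 1, w.2) : Face) ∉ D ∨ ((w.1 + 1, w.2 - 1) : Face) ∉ D)
    (heast : ∀ x : ℤ, w.1 + 2 ≤ x → ((x, w.2) : Face) ∉ D ∨ ((x, w.2 - 1) : Face) ∉ D)
    (ω : ΩG D (w.side .W) (farW w)) (hr : RootedFace D (w.side .W) (farW w)) (h : ω.IsB2a) {θ : ℝ}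
    (hW : ω.WE (fun _ => θ) ≠ excursionWinding θ ω.2.firstSideG (ω.z1 hr h) ω.1) :
    ω.2.kindsIn w = [.corner, .corner] := by
  rcases ω.AJ_ne_zero_or_rev_of_wound hr h θ hW with hA | hA
  · exact kindsIn_root_eq_of_AJ_ne_zero_eastWall hh hSE heast ω hr h hA
  · have h' := ω.rev_isB2a hr h
    have hk := kindsIn_root_eq_of_AJ_ne_zero_eastWall hh hSE heast (ω.rev hr) hr h' hA
    have hperm := ω.kindsIn_rev_perm hr h (root_ne_farW w)
    rw [hk] at hperm
    have hp : (ω.2.kindsIn w).Perm (List.replicate 2 .corner) := hperm.symm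
    exact List.perm_replicate.1 hp

/-- ★★★★ On the east wall no wound walk at the far cell is `w₁`-free off the far cell.
[cite: GlazmanManolescu2019, §1, remark after eq. (1)] [cite: Glazman2015WeightedSAW, Lemma 3.1 (proof, pp. 6–7)] -/
theorem not_W1FreeOff_of_wound_eastWall (hh : holeFaceW w ∉ D)
    (hSE : ((w.1 + 1, w.2) : Face) ∉ D ∨ ((w.1 + 1, w.2 - 1) : Face) ∉ D)
    (heast : ∀ x : ℤ, w.1 + 2 ≤ x → ((x, w.2) : Face) ∉ D ∨ ((x, w.2 - 1) : Face) ∉ D)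
    (ω : ΩG D (w.side .W) (farW w)) (hr : RootedFace D (w.side .W) (farW w)) (h : ω.IsB2a) {θ : ℝ}
    (hW : ω.WE (fun _ => θ) ≠ excursionWinding θ ω.2.firstSideG (ω.z1 hr h) ω.1) : ¬ω.2.W1FreeOff (farW w) := by
  have hk := kindsIn_root_eq_of_wound_eastWall hh hSE heast ω hr h hW
  intro hfree
  have hmem : w ∈ ω.2.facesVisited := by
    by_contra hn
    rw [YBWalk.kindsIn_eq_nil hn] at hk
    exact List.cons_ne_nil _ _ hk.symm
  exact hfree _ hmem (root_ne_farW w) hk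

/-! ## §3 The root plaquette's eastern neighbour absent: no walk is wound -/

/-- ★★★★★ **THE ROOT PLAQUETTE'S EASTERN NEIGHBOUR ON THE WALL EMPTIES BOTH ROUTES.** Hole absent, `(w.1 + 1, w.2) ∉ D`,
the wall beyond: a wound walk would carry two `θ`-corner arcs in `w`, neither through its `E` side (no cell behind it) —
so both through its `N` side, one mid-edge visited twice. Hence NO class-`B2a` walk at the far cell is wound.
[cite: GlazmanManolescu2019, §1 (Fig. 1: the two θ-corner arcs), Lemma 2.1 (statement, "in the form given in [Gl]")]
[cite: Glazman2015WeightedSAW, Lemma 3.1 (proof, pp. 6–7)] [cite: CourantRobbins1958, Ch. V Appendix §2 (the even–odd rule)] -/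
theorem WE_eq_excursionWinding_of_eastWallRootE (hh : holeFaceW w ∉ D) (hE : ((w.1 + 1, w.2) : Face) ∉ D)
    (heast : ∀ x : ℤ, w.1 + 2 ≤ x → ((x, w.2) : Face) ∉ D ∨ ((x, w.2 - 1) : Face) ∉ D)
    (ω : ΩG D (w.side .W) (farW w)) (hr : RootedFace D (w.side .W) (farW w)) (h : ω.IsB2a) (θ : ℝ) :
    ω.WE (fun _ => θ) = excursionWinding θ ω.2.firstSideG (ω.z1 hr h) ω.1 := by
  by_contra hW
  have hk := kindsIn_root_eq_of_wound_eastWall hh (Or.inl hE) heast ω hr h hW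
  obtain ⟨i, j, hij, hj, hfi, hfj⟩ :=
    ω.2.exists_two_arcs_of_two_le_length_kindsIn (f := w) (by rw [hk]; simp)
  have hi : i < ω.2.arcs.length := by omega
  -- both arcs in `w` are corner arcs
  have hcc : ∀ {k : ℕ} (hk' : k < ω.2.arcs.length), ω.2.fc k = w →
      arcKind (ω.2.sIn k) (ω.2.sOut k) = .corner := by
    intro k hk' hfk
    have hm := ω.2.arcKind_mem_kindsIn hk'
    rw [hfk, hk] at hm
    simpa using hm
  -- no arc in `w` passes through its `E` side (the cell behind it is absent)
  have noE : ∀ {k : ℕ} (hk' : k < ω.2.arcs.length), ω.2.fc k = w → ω.2.sIn k ≠ .E ∧ ω.2.sOut k ≠ .E := by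
    intro k hk' hfk
    obtain ⟨h1, h2, -⟩ := ω.2.side_sIn_nth hk'
    rw [hfk] at h1 h2
    constructor
    · intro e
      rw [e] at h1
      have hk0 : 0 < k := by
        rcases Nat.eq_zero_or_pos k with e0 | hpos
        · exfalso
          rw [e0, YBWalk.nth_zero] at h1
          exact root_side_W_ne_root_side_E w h1.symm
        · exact hpos
      have hd := ω.2.door_nth hk0 hk'
      rw [← h1, root_side_E_faces_snd] at hd
      exact hE hd.2
    · intro e
      rw [e] at h2
      rcases Nat.lt_or_ge (k + 1) ω.2.arcs.length with hlt | hge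
      · have hd := ω.2.door_nth (j := k + 1) (by omega) hlt
        rw [← h2, root_side_E_faces_snd] at hd
        exact hE hd.2
      · have ek : k + 1 = ω.2.arcs.length := by omega
        rw [ek, YBWalk.nth_length] at h2
        exact farW_side_ne_root_side_E w ω.1 h2.symm
  -- so both arcs pass through the `N` side: the same mid-edge at two different indices
  have hN : ∀ {k : ℕ} (hk' : k < ω.2.arcs.length), ω.2.fc k = w →
      ω.2.nth k = w.side .N ∨ ω.2.nth (k + 1) = w.side .N := by
    intro k hk' hfk
    obtain ⟨h1, h2, -⟩ := ω.2.side_sIn_nth hk'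
    rw [hfk] at h1 h2
    obtain ⟨n1, n2⟩ := noE hk' hfk
    rcases corner_side_N_of_ne_E (hcc hk' hfk) n1 n2 with e | e
    · left; rw [← h1, e]
    · right; rw [← h2, e]
  have hij1 : i + 1 ≠ j := by
    intro e
    have hne := ω.2.fc_succ_ne (i := i) (by omega)
    rw [e, hfi, hfj] at hne
    exact hne rfl
  have hn := ω.2.length_arcs
  rcases hN hi hfi with ei | ei <;> rcases hN hj hfj with ej | ej
  · have := ω.2.nth_inj (by omega) (by omega) (ei.trans ej.symm); omega
  · have := ω.2.nth_inj (by omega) (by omega) (ei.trans ej.symm); omega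
  · have := ω.2.nth_inj (by omega) (by omega) (ei.trans ej.symm); omega
  · have := ω.2.nth_inj (by omega) (by omega) (ei.trans ej.symm); omega

/-- ★★★ Both route masses vanish identically once the root plaquette's eastern neighbour on the wall is absent.
[cite: GlazmanManolescu2019, Lemma 2.1 (statement, "in the form given in [Gl]")] -/
theorem sum_routeMassW_eq_zero_of_eastWallRootE [Finite D] (hh : holeFaceW w ∉ D) (hE : ((w.1 + 1, w.2) : Face) ∉ D)
    (heast : ∀ x : ℤ, w.1 + 2 ≤ x → ((x, w.2) : Face) ∉ D ∨ ((x, w.2 - 1) : Face) ∉ D)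
    (hr : RootedFace D (w.side .W) (farW w)) (s : Side) (θ : ℝ) :
    ∑ ω ∈ setB2a D (w.side .W) (farW w), routeMassW θ hr s ω = 0 := by
  classical
  refine Finset.sum_eq_zero fun ω _ => ?_
  unfold routeMassW
  split_ifs with h1 h2
  · exact absurd (WE_eq_excursionWinding_of_eastWallRootE hh hE heast ω hr h1 θ) h2.2
  · rfl
  · rfl

/-! ## §4 An eastern pocket on the wall: the row mirror for the north-eastern pocket -/

/-- The reflection on a cell, in coordinates. [cite: GlazmanManolescu2019, §4.2 (lattice symmetries)] -/
private theorem mirrorRowFace_mkEW (w : Face) (x y : ℤ) : mirrorRowFace w.2 ((x, y) : Face) = (x, 2 * w.2 - y) := by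
  simp [mirrorRowFace]

/-- ★★★★ **NORTH-EASTERN POCKET ON THE WALL ⇒ EVERY WOUND WALK IS `w₂`-MARKED** (row mirror of §2: the reflected walk is
`w₁`-marked in `w`, i.e. the walk carries two `(π − θ)`-corner arcs in `w`).
[cite: GlazmanManolescu2019, §1 (the paragraph of Fig. 2), §4.2 (lattice symmetries), Lemma 2.1]
[cite: Glazman2015WeightedSAW, Lemma 3.1 (proof, pp. 6–7)] [cite: CourantRobbins1958, Ch. V Appendix §2 (the even–odd rule)] -/
theorem not_W2FreeOff_of_wound_eastWallNE (hh : holeFaceW w ∉ D)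
    (hNE : ((w.1 + 1, w.2) : Face) ∉ D ∨ ((w.1 + 1, w.2 + 1) : Face) ∉ D)
    (heast : ∀ x : ℤ, w.1 + 2 ≤ x → ((x, w.2) : Face) ∉ D ∨ ((x, w.2 + 1) : Face) ∉ D)
    (ω : ΩG D (w.side .W) (farW w)) (hr : RootedFace D (w.side .W) (farW w)) (h : ω.IsB2a) {θ : ℝ}
    (hW : ω.WE (fun _ => θ) ≠ excursionWinding θ ω.2.firstSideG (ω.z1 hr h) ω.1) : ¬ω.2.W2FreeOff (farW w) := by
  have hr' := rootedFace_rowMirrorDom w hr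
  have h' := ω.mirrorFar_isB2a hr h
  have hh' : holeFaceW w ∉ rowMirrorDom w D := by rwa [mem_rowMirrorDom, mirrorRowFace_holeFaceW]
  have hSE' : ((w.1 + 1, w.2) : Face) ∉ rowMirrorDom w D ∨ ((w.1 + 1, w.2 - 1) : Face) ∉ rowMirrorDom w D := by
    rcases hNE with hx | hx
    · left; rw [mem_rowMirrorDom, mirrorRowFace_mkEW, show 2 * w.2 - w.2 = w.2 by ring]; exact hx
    · right; rw [mem_rowMirrorDom, mirrorRowFace_mkEW, show 2 * w.2 - (w.2 - 1) = w.2 + 1 by ring]; exact hx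
  have heast' : ∀ x : ℤ, w.1 + 2 ≤ x → ((x, w.2) : Face) ∉ rowMirrorDom w D ∨
      ((x, w.2 - 1) : Face) ∉ rowMirrorDom w D := by
    intro x hx
    simp only [mem_rowMirrorDom, mirrorRowFace_mkEW, show 2 * w.2 - w.2 = w.2 by ring,
      show 2 * w.2 - (w.2 - 1) = w.2 + 1 by ring]
    exact heast x hx
  have hk := kindsIn_root_eq_of_wound_eastWall hh' hSE' heast' ω.mirrorFar hr' h' (ω.mirrorFar_wound hr h hW)
  have hk2 := ω.kindsIn_eq_coCorner_of_mirrorFar_corner hk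
  rw [mirrorRowFace_self] at hk2
  intro hfree
  have hmem : w ∈ ω.2.facesVisited := by
    by_contra hn
    rw [YBWalk.kindsIn_eq_nil hn] at hk2
    exact List.cons_ne_nil _ _ hk2.symm
  exact hfree _ hmem (root_ne_farW w) hk2

end ΩG

end Literature.Probability.RandomPlanarGeometry.SAW.YangBaxter

namespace Literature.Barriers.CriticalPhenomena.PlaquetteWalk

open Literature.Probability.RandomPlanarGeometry.SAW.YangBaxter
open Real Complex

/-! ## §5 The vertex functional: `VF ≡ 0`, `VF(2π/3) = 0`, `VF(π/3) = 0` -/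

section Signs

variable {Dl : List Face} {w : Face}

/-- ★★★★★ **ROOT PLAQUETTE'S EASTERN NEIGHBOUR ON THE WALL ⇒ THE VERTEX RELATION HOLDS AT THE FAR CELL FOR EVERY
`θ ∈ [π/3, 2π/3]`** (both routes empty). [cite: GlazmanManolescu2019, Lemma 2.1 (statement, "in the form given in [Gl]")]
[cite: Glazman2015WeightedSAW, Lemma 3.1 (proof, pp. 6–7)] -/
theorem vertexFunctional_printed_eq_zero_of_eastWallRootE {θ : ℝ} (hθ : θ ∈ Set.Icc (π / 3) (2 * π / 3))
    (hf : farW w ∈ Dl) (hh : holeFaceW w ∉ dom Dl) (hE : ((w.1 + 1, w.2) : Face) ∉ dom Dl)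
    (heast : ∀ x : ℤ, w.1 + 2 ≤ x → ((x, w.2) : Face) ∉ dom Dl ∨ ((x, w.2 - 1) : Face) ∉ dom Dl) :
    vertexFunctional (printedWeights θ) tFiveEighths (ybCoeff θ) Dl (w.side .W) (farW w) = 0 := by
  have hr : RootedFace (dom Dl) (w.side .W) (farW w) := ⟨hf, fun hb => hh (by rw [root_faces_W] at hb; exact hb.1)⟩
  rw [vertexFunctional_printed_farCellW_eq hθ Dl w hf hh hr,
    ΩG.sum_routeMassW_eq_zero_of_eastWallRootE hh hE heast hr .S θ,
    ΩG.sum_routeMassW_eq_zero_of_eastWallRootE hh hE heast hr .N θ]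
  simp

/-- ★★★★ **SOUTH-EASTERN POCKET ON THE WALL ⇒ THE DUAL HONEYCOMB ZERO `VF(2π/3) = 0`** (every wound walk `w₁`-marked).
[cite: GlazmanManolescu2019, §1, remark after eq. (1), Lemma 2.1] [cite: Glazman2015WeightedSAW, Lemma 3.1 (proof, pp. 6–7)] -/
theorem vertexFunctional_printed_two_pi_div_three_eq_zero_of_eastWallPocketSE (hf : farW w ∈ Dl)
    (hh : holeFaceW w ∉ dom Dl) (hP : ((w.1 + 1, w.2 - 1) : Face) ∉ dom Dl)
    (heast : ∀ x : ℤ, w.1 + 2 ≤ x → ((x, w.2) : Face) ∉ dom Dl ∨ ((x, w.2 - 1) : Face) ∉ dom Dl) :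
    vertexFunctional (printedWeights (2 * π / 3)) tFiveEighths (ybCoeff (2 * π / 3)) Dl (w.side .W) (farW w) = 0 := by
  have hr : RootedFace (dom Dl) (w.side .W) (farW w) := ⟨hf, fun hb => hh (by rw [root_faces_W] at hb; exact hb.1)⟩
  exact vertexFunctional_printed_farCellW_two_pi_div_three_eq_zero_of_killed Dl w hf hh hr
    fun ω h hW => ΩG.not_W1FreeOff_of_wound_eastWall hh (Or.inr hP) heast ω hr h hW

/-- ★★★★ **NORTH-EASTERN POCKET ON THE WALL ⇒ THE HONEYCOMB ZERO `VF(π/3) = 0`** (every wound walk `w₂`-marked).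
[cite: GlazmanManolescu2019, §1 eq. (1) («w₂ = 0 at θ = π/3»), Lemma 2.1] [cite: Glazman2015WeightedSAW, Lemma 3.1 (proof, pp. 6–7)] -/
theorem vertexFunctional_printed_pi_div_three_eq_zero_of_eastWallPocketNE (hf : farW w ∈ Dl)
    (hh : holeFaceW w ∉ dom Dl) (hP : ((w.1 + 1, w.2 + 1) : Face) ∉ dom Dl)
    (heast : ∀ x : ℤ, w.1 + 2 ≤ x → ((x, w.2) : Face) ∉ dom Dl ∨ ((x, w.2 + 1) : Face) ∉ dom Dl) :
    vertexFunctional (printedWeights (π / 3)) tFiveEighths (ybCoeff (π / 3)) Dl (w.side .W) (farW w) = 0 := by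
  have hr : RootedFace (dom Dl) (w.side .W) (farW w) := ⟨hf, fun hb => hh (by rw [root_faces_W] at hb; exact hb.1)⟩
  exact vertexFunctional_printed_farCellW_pi_div_three_eq_zero_of_killed Dl w hf hh hr
    fun ω h hW => ΩG.not_W2FreeOff_of_wound_eastWallNE hh (Or.inr hP) heast ω hr h hW

end Signs

/-! ## §6 LAW L's residual east cells, all boxes -/

section Boxes

variable {m n : ℕ} {h : Face}

/-- ★★★★★ **LAW L's EAST RESIDUAL CELL `(h.1 + 2, h.2)`, ALL BOXES: THE VERTEX RELATION HOLDS ON THE WHOLE RANGE.** In the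
`m × n` box with the hole `h` two columns from the eastern wall (`h.1 + 3 = m`, `1 ≤ h.1`, `0 ≤ h.2`, `h.2 + 1 ≤ n`),
removing the eastern neighbour `(h.1 + 2, h.2)` of the root plaquette `(h.1 + 1, h.2)` alone ⇒ `VF(θ) = 0` for every
`θ ∈ [π/3, 2π/3]` (no walk at the far cell is wound). [cite: GlazmanManolescu2019, Lemma 2.1 (statement, "in the form given in [Gl]"), §2.1]
[cite: Glazman2015WeightedSAW, Lemma 3.1 (proof, pp. 6–7)] -/
theorem lawL_box_eastWallRootE_vertexFunctional_eq_zero (hW : 1 ≤ h.1) (hE : h.1 + 3 = m) (hS : 0 ≤ h.2)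
    (hN : h.2 + 1 ≤ n) {θ : ℝ} (hθ : θ ∈ Set.Icc (π / 3) (2 * π / 3)) :
    vertexFunctional (printedWeights θ) tFiveEighths (ybCoeff θ) (boxMinus m n [h, (h.1 + 2, h.2)])
      (Face.side (h.1 + 1, h.2) .W) (farW (h.1 + 1, h.2)) = 0 := by
  refine vertexFunctional_printed_eq_zero_of_eastWallRootE hθ ?_ ?_ ?_ fun x hx => ?_
  · rw [mem_boxMinus]; simp only [farW, List.mem_cons, List.not_mem_nil, or_false, not_or]
    refine ⟨⟨by omega, by omega, by omega, by omega⟩, fun e => ?_, fun e => ?_⟩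
    · have e' := Prod.ext_iff.1 e; simp only at e'; omega
    · have e' := Prod.ext_iff.1 e; simp only at e'; omega
  · rw [holeFaceW_hroot]; exact not_mem_dom_boxMinus_of_mem (by simp)
  · have e : (((h.1 + 1, h.2) : Face).1 + 1, ((h.1 + 1, h.2) : Face).2) = ((h.1 + 2, h.2) : Face) :=
      Prod.ext (by simp only; ring) rfl
    rw [e]; exact not_mem_dom_boxMinus_of_mem (by simp)
  · left; intro hm; have hb := (mem_dom_boxMinus.1 hm).1; simp only at hb hx; omega

/-- ★★★★ **LAW L's EAST RESIDUAL CELL `(h.1 + 2, h.2 − 1)`: `VF(2π/3) = 0`** (the south-eastern pocket on the wall).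
[cite: GlazmanManolescu2019, §1, remark after eq. (1), Lemma 2.1, §2.1] [cite: Glazman2015WeightedSAW, Lemma 3.1 (proof, pp. 6–7)] -/
theorem lawL_box_eastWallPocketSE_vertexFunctional_two_pi_div_three_eq_zero (hW : 1 ≤ h.1) (hE : h.1 + 3 = m)
    (hS : 0 ≤ h.2) (hN : h.2 + 1 ≤ n) :
    vertexFunctional (printedWeights (2 * π / 3)) tFiveEighths (ybCoeff (2 * π / 3))
      (boxMinus m n [h, (h.1 + 2, h.2 - 1)]) (Face.side (h.1 + 1, h.2) .W) (farW (h.1 + 1, h.2)) = 0 := by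
  refine vertexFunctional_printed_two_pi_div_three_eq_zero_of_eastWallPocketSE ?_ ?_ ?_ fun x hx => ?_
  · rw [mem_boxMinus]; simp only [farW, List.mem_cons, List.not_mem_nil, or_false, not_or]
    refine ⟨⟨by omega, by omega, by omega, by omega⟩, fun e => ?_, fun e => ?_⟩
    · have e' := Prod.ext_iff.1 e; simp only at e'; omega
    · have e' := Prod.ext_iff.1 e; simp only at e'; omega
  · rw [holeFaceW_hroot]; exact not_mem_dom_boxMinus_of_mem (by simp)
  · have e : (((h.1 + 1, h.2) : Face).1 + 1, ((h.1 + 1, h.2) : Face).2 - 1) = ((h.1 + 2, h.2 - 1) : Face) :=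
      Prod.ext (by simp only; ring) rfl
    rw [e]; exact not_mem_dom_boxMinus_of_mem (by simp)
  · left; intro hm; have hb := (mem_dom_boxMinus.1 hm).1; simp only at hb hx; omega

/-- ★★★★ **LAW L's EAST RESIDUAL CELL `(h.1 + 2, h.2 + 1)`: `VF(π/3) = 0`** (the north-eastern pocket on the wall).
[cite: GlazmanManolescu2019, §1 eq. (1), Lemma 2.1, §2.1] [cite: Glazman2015WeightedSAW, Lemma 3.1 (proof, pp. 6–7)] -/
theorem lawL_box_eastWallPocketNE_vertexFunctional_pi_div_three_eq_zero (hW : 1 ≤ h.1) (hE : h.1 + 3 = m)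
    (hS : 0 ≤ h.2) (hN : h.2 + 1 ≤ n) :
    vertexFunctional (printedWeights (π / 3)) tFiveEighths (ybCoeff (π / 3))
      (boxMinus m n [h, (h.1 + 2, h.2 + 1)]) (Face.side (h.1 + 1, h.2) .W) (farW (h.1 + 1, h.2)) = 0 := by
  refine vertexFunctional_printed_pi_div_three_eq_zero_of_eastWallPocketNE ?_ ?_ ?_ fun x hx => ?_
  · rw [mem_boxMinus]; simp only [farW, List.mem_cons, List.not_mem_nil, or_false, not_or]
    refine ⟨⟨by omega, by omega, by omega, by omega⟩, fun e => ?_, fun e => ?_⟩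
    · have e' := Prod.ext_iff.1 e; simp only at e'; omega
    · have e' := Prod.ext_iff.1 e; simp only at e'; omega
  · rw [holeFaceW_hroot]; exact not_mem_dom_boxMinus_of_mem (by simp)
  · have e : (((h.1 + 1, h.2) : Face).1 + 1, ((h.1 + 1, h.2) : Face).2 + 1) = ((h.1 + 2, h.2 + 1) : Face) :=
      Prod.ext (by simp only; ring) rfl
    rw [e]; exact not_mem_dom_boxMinus_of_mem (by simp)
  · left; intro hm; have hb := (mem_dom_boxMinus.1 hm).1; simp only at hb hx; omega

end Boxes

end Literature.Barriers.CriticalPhenomena.PlaquetteWalk
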